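import Literature.MathematicalPhysics.QuantumFieldTheory.HeppBoundProofs
import Literature.MathematicalPhysics.QuantumFieldTheory.CycleMatroidSpanningTrees
import HarnessLib

/-!
# Hepp sectors: dominance of Kruskal's tree, and sectors overlap only in ties (Panzer 2022, §2.2)

Topic `MathematicalPhysics/QuantumFieldTheory`. Companion of `HeppBoundProofs.lean` (the upper half
`P(G) ≤ H(G)` of Panzer's eq. (1.6), proved sector by sector) preparing the LOWER half
(`HeppBoundLowerHalf.lean`, which adds the matrix-tree expansion of `MatrixTreeTheorem.lean`). PUBLISHED
statements with proofs; no named fact, no definition, no `sorry`. Everything here needs only the tree as it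
stands (`HeppBoundProofs`, `CycleMatroidSpanningTrees`, `GraphPeriodHeppBound.exists_greedyRows`).

SOURCE (held, `paper:arxiv-1908.09820`): E. Panzer, *Hepp's bound for Feynman graphs and matroids*, AIHPD 10
(2023) 31–119 [Panzer2022]. §2.2, chunk p0007:L64–L76 VERBATIM: "Each summand is an integral over the projective
simplex with `0 < x_{σ(1)} < ⋯ < x_{σ(N)}`. Hepp noted that within every sector `H_σ`, there is a unique spanning
tree `T_σ ∈ ST_G` that dominates all others, i.e. the function `Ψ^trop_G` is given by a fixed monomial inside the
sector: `Ψ^trop_G(x)|_{x∈H_σ} = Π_{e∉T_σ} x_e`. (∗) Indeed, the dominating spanning tree `T_σ` … is nothing but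
the minimum weight spanning tree with respect to the edge weights `log x_e`, and following Kruskal this spanning
tree is uniquely determined by the total order `σ` of the weights: **Lemma 2.8** (Kruskal's greedy algorithm).
If we are given a total order of the edge weights, hence a permutation `σ ∈ 𝔖_N` of the edges, then the minimum
weight spanning forest `T_σ` consists of precisely those edges that do not increase the loop number"; §2.3,
chunks p0008:L77–L80 (rank = maximal size of an independent subset) and p0009:L58 "recall that
`max_T |γ ∩ T| = rank γ`"; §1 eq. (1.7), chunk p0003:L84–L90 (Hepp sectors `H_σ = {x_{σ(1)} < ⋯ < x_{σ(N)}}`).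

WHAT IS TYPED (all PROVED; namespace `Literature.MathematicalPhysics.QuantumFieldTheory`):
* § `Majorization` (private) — if `#S = #T` and every prefix `[0, m)` meets `T` at least as often as `S`, then
  for sorted non-negative weights `Π_{e∈T} y_e ≤ Π_{e∈S} y_e` (the `i`-th smallest element of `T` precedes
  that of `S`; `Finset.orderEmbOfFin`).
* § `SpanningTrees` — **`IsSpanningTree.card_inter_le_edgeRank`** (`#(T ∩ γ) ≤ rk γ` for a spanning tree
  `T`: its edges are independent in the tree's `cycleMatroid`), **`exists_greedy_isSpanningTree`** (Lemma 2.8: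
  a connected edge list has a spanning tree meeting every prefix `{e < m}` in exactly `rk{e < m}` edges —
  Kruskal's tree of the labelling ORDER, weight-free), **`IsSpanningTree.prod_compl_le_of_greedy`** (eq. (∗),
  DOMINANCE: for positive weights sorted along the labelling that tree's co-tree monomial `Π_{e∉T} y_e` is
  `≥` the co-tree monomial of every spanning tree), and relabelling lemmas `isSpanningTree_comp_perm`,
  `card_filter_isSpanningTree_comp_perm` (the number of spanning trees is invariant), `prod_compl_map_perm`.
* § `Ties` — **`volume_setOf_not_injective_snoc`**: the `x ∈ ℝⁿ` whose weight vector `(x, 1)` (chart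
  `x_N = 1`) has a tie form a Lebesgue-null set (finite union of hyperplanes `{x_a = x_b}`, `{x_a = 1}`).
* § `Sector` — **`mem_openOrthant_and_eq_ofFn_sort_of_sector_ne_zero`**: the sector function
  `L 0 x · U n x` of an ordering `l` (the integrand of `HeppBoundProofs.lintegral_sector_eq`, in its
  `rfl`-instantiated hypotheses) vanishes unless `0 < y_{l_0} ≤ ⋯ ≤ y_{l_n}`; off the ties this forces
  `x ∈ openOrthant n` and `l = List.ofFn (Tuple.sort (x, 1))` (Mathlib `Tuple.unique_monotone`) — distinct
  Hepp sectors overlap only in the null set of ties, the fact that lets the sector integrals be ADDED in the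
  lower half of (1.6) (the upper half only needed that every `x` lies in SOME sector).
* (v2) § `Uniqueness` — **`IsSpanningTree.prod_compl_lt_of_greedy_of_ne`** (on an OPEN sector, strictly
  increasing weights, Kruskal's tree STRICTLY dominates every other spanning tree) and
  **`IsSpanningTree.eq_greedy_of_forall_prod_compl_le`** (hence a dominating spanning tree IS Kruskal's:
  "a unique spanning tree `T_σ` that dominates all others", "uniquely determined by the total order `σ`").

## References

* [Panzer2022] E. Panzer, AIHPD 10 (2023) 31–119, doi:10.4171/aihpd/126, arXiv:1908.09820 — §1 eq. (1.7),
  §2.2 eq. (∗) and Lemma 2.8, §2.3 (rank; proof of Lemma 2.16), Def. 2.4 (sum over orderings).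
-/

noncomputable section

open Matrix Finset MeasureTheory ENNReal Function
open Literature.Combinatorics.Matroid

namespace Literature.MathematicalPhysics.QuantumFieldTheory

/-! ### Majorization of monomials along a sorted weight vector -/

section Majorization

variable {N : ℕ}

/-- If `S` and `T` have the same size and every prefix `[0, m)` meets `T` at least as often as `S`,
then the `i`-th smallest element of `T` is at most the `i`-th smallest element of `S`. [folklore] -/
private theorem orderEmbOfFin_le_of_card_inter_ltFilter_le {S T : Finset (Fin N)} {r : ℕ}
    (hS : S.card = r) (hT : T.card = r)
    (h : ∀ m : ℕ, (S ∩ univ.filter fun k : Fin N => (k : ℕ) < m).card ≤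
      (T ∩ univ.filter fun k : Fin N => (k : ℕ) < m).card) (i : Fin r) :
    T.orderEmbOfFin hT i ≤ S.orderEmbOfFin hS i := by
  by_contra hlt
  rw [not_le] at hlt
  set s := S.orderEmbOfFin hS with hs
  set t := T.orderEmbOfFin hT with ht
  set m : ℕ := (s i : ℕ) + 1 with hm
  -- at least `i + 1` elements of `S` lie below `m`
  have h1 : (i : ℕ) + 1 ≤ (S ∩ univ.filter fun k : Fin N => (k : ℕ) < m).card := by
    have hsub : (Finset.Iic i).image s ⊆ S ∩ univ.filter fun k : Fin N => (k : ℕ) < m := by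
      intro e he
      obtain ⟨j, hj, rfl⟩ := Finset.mem_image.1 he
      refine Finset.mem_inter.2 ⟨Finset.orderEmbOfFin_mem S hS j, (Finset.mem_filter_univ _).2 ?_⟩
      have hji : s j ≤ s i := s.monotone (Finset.mem_Iic.1 hj)
      rw [Fin.le_def] at hji
      omega
    have hcard : ((Finset.Iic i).image s).card = (i : ℕ) + 1 := by
      rw [Finset.card_image_of_injective _ s.injective, Fin.card_Iic]
    exact hcard ▸ Finset.card_le_card hsub
  -- at most `i` elements of `T` lie below `m`
  have h2 : (T ∩ univ.filter fun k : Fin N => (k : ℕ) < m).card ≤ (i : ℕ) := by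
    have hsub : T ∩ (univ.filter fun k : Fin N => (k : ℕ) < m) ⊆ (Finset.Iio i).image t := by
      intro e he
      obtain ⟨heT, hem⟩ := Finset.mem_inter.1 he
      rw [Finset.mem_filter_univ] at hem
      have he' : e ∈ univ.image t := by rw [ht, Finset.image_orderEmbOfFin_univ T hT]; exact heT
      obtain ⟨j, -, rfl⟩ := Finset.mem_image.1 he'
      refine Finset.mem_image.2 ⟨j, Finset.mem_Iio.2 ?_, rfl⟩
      by_contra hji
      rw [not_lt] at hji
      have hij : t i ≤ t j := t.monotone hji
      rw [Fin.le_def] at hij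
      rw [Fin.lt_def] at hlt
      omega
    calc (T ∩ univ.filter fun k : Fin N => (k : ℕ) < m).card ≤ ((Finset.Iio i).image t).card :=
          Finset.card_le_card hsub
      _ ≤ (Finset.Iio i).card := Finset.card_image_le
      _ = (i : ℕ) := Fin.card_Iio i
  have h3 := h m
  omega

/-- **Majorization of monomials.** For non-negative weights `y₀ ≤ y₁ ≤ ⋯` and `S`, `T` of the
same size with `#(S ∩ [0,m)) ≤ #(T ∩ [0,m))` for all `m`, `Π_{e∈T} y_e ≤ Π_{e∈S} y_e`. [folklore] -/
private theorem prod_le_prod_of_card_inter_ltFilter_le {S T : Finset (Fin N)} {r : ℕ}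
    (hS : S.card = r) (hT : T.card = r)
    (h : ∀ m : ℕ, (S ∩ univ.filter fun k : Fin N => (k : ℕ) < m).card ≤
      (T ∩ univ.filter fun k : Fin N => (k : ℕ) < m).card)
    (y : Fin N → ℝ) (hy0 : ∀ k, 0 ≤ y k) (hmono : Monotone y) :
    ∏ e ∈ T, y e ≤ ∏ e ∈ S, y e := by
  rw [← Finset.image_orderEmbOfFin_univ T hT, ← Finset.image_orderEmbOfFin_univ S hS,
    Finset.prod_image fun a _ b _ hab => (T.orderEmbOfFin hT).injective hab,
    Finset.prod_image fun a _ b _ hab => (S.orderEmbOfFin hS).injective hab]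
  exact Finset.prod_le_prod (fun i _ => hy0 _) fun i _ =>
    hmono (orderEmbOfFin_le_of_card_inter_ltFilter_le hS hT h i)

/-- **Majorization of the complementary monomials.** For positive weights `y₀ ≤ y₁ ≤ ⋯` and `S`,
`T` as above, `Π_{e∉S} y_e ≤ Π_{e∉T} y_e`. [folklore] -/
private theorem prod_compl_le_prod_compl_of_card_inter_ltFilter_le {S T : Finset (Fin N)} {r : ℕ}
    (hS : S.card = r) (hT : T.card = r)
    (h : ∀ m : ℕ, (S ∩ univ.filter fun k : Fin N => (k : ℕ) < m).card ≤
      (T ∩ univ.filter fun k : Fin N => (k : ℕ) < m).card)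
    (y : Fin N → ℝ) (hy : ∀ k, 0 < y k) (hmono : Monotone y) :
    ∏ e ∈ Sᶜ, y e ≤ ∏ e ∈ Tᶜ, y e := by
  have hle := prod_le_prod_of_card_inter_ltFilter_le hS hT h y (fun k => (hy k).le) hmono
  have hposS : 0 < ∏ e ∈ S, y e := Finset.prod_pos fun e _ => hy e
  have hU : (∏ e ∈ Sᶜ, y e) * ∏ e ∈ S, y e = (∏ e ∈ Tᶜ, y e) * ∏ e ∈ T, y e := by
    rw [mul_comm, Finset.prod_mul_prod_compl, mul_comm, Finset.prod_mul_prod_compl]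
  refine le_of_mul_le_mul_right ?_ hposS
  rw [hU]
  exact mul_le_mul_of_nonneg_left hle (Finset.prod_nonneg fun e _ => (hy e).le)

end Majorization

/-! ### Spanning trees: prefix counts and relabelling -/

section SpanningTrees

variable {N V : ℕ}

/-- **A spanning tree meets every edge set `γ` in at most `rk γ` edges** (its edges are independent
in the cycle matroid, and the rank of `γ` is the maximal size of an independent subset; Panzer 2022, §2.3,
proof of Lemma 2.16: "recall that `max_T |γ ∩ T| = rank γ`"). [cite: Panzer2022, §2.3 (definition of the rank; proof of Lemma 2.16), chunks p0008:L77–L80, p0009:L58] -/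
theorem IsSpanningTree.card_inter_le_edgeRank {E : Fin N → Fin (V + 1) × Fin (V + 1)}
    {T : Finset (Fin N)} (hT : IsSpanningTree E T) (γ : Finset (Fin N)) :
    (T ∩ γ).card ≤ edgeRank E γ := by
  have hI : (cycleMatroid E).Indep (T : Set (Fin N)) :=
    (indep_cycleMatroid_iff_edgeRank E T).2 (hT.2.trans hT.1.symm)
  have hI' : (cycleMatroid E).Indep ((T ∩ γ : Finset (Fin N)) : Set (Fin N)) :=
    hI.subset (by rw [Finset.coe_inter]; exact Set.inter_subset_left)
  have h1 : ((T ∩ γ).card : ℕ∞) ≤ (edgeRank E γ : ℕ∞) := by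
    rw [← Set.encard_coe_eq_coe_finsetCard, ← hI'.eRk_eq_encard, ← eRk_cycleMatroid_eq_edgeRank]
    exact (cycleMatroid E).eRk_mono (by rw [Finset.coe_inter]; exact Set.inter_subset_right)
  exact_mod_cast h1

/-- **Dominance of Kruskal's tree on a Hepp sector** (Panzer 2022, §2.2 eq. (∗) with Lemma 2.8: "within
every sector `H_σ`, there is a unique spanning tree `T_σ` that dominates all others"). For positive weights
sorted along the labelling, `y₀ ≤ y₁ ≤ ⋯`, a set `T` of `V` edges meeting every prefix `G_m = {e < m}` in
exactly `rk G_m` edges (Kruskal's greedy tree, `GraphPeriodHeppBound.exists_greedyRows`) has the LARGEST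
co-tree monomial: `Π_{e∉T'} y_e ≤ Π_{e∉T} y_e` for every spanning tree `T'`. [cite: Panzer2022, §2.2 eq. (∗) and Lemma 2.8 (chunk p0007:L64–L76)] -/
theorem IsSpanningTree.prod_compl_le_of_greedy {E : Fin N → Fin (V + 1) × Fin (V + 1)}
    {T' : Finset (Fin N)} (hT' : IsSpanningTree E T') {T : Finset (Fin N)} (hT : T.card = V)
    (hcount : ∀ m : ℕ, (T ∩ univ.filter fun k : Fin N => (k : ℕ) < m).card =
      edgeRank E (univ.filter fun k : Fin N => (k : ℕ) < m))
    (y : Fin N → ℝ) (hy : ∀ e, 0 < y e) (hmono : Monotone y) :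
    ∏ e ∈ T'ᶜ, y e ≤ ∏ e ∈ Tᶜ, y e :=
  prod_compl_le_prod_compl_of_card_inter_ltFilter_le hT'.1 hT
    (fun m => (hT'.card_inter_le_edgeRank _).trans (hcount m).ge) y hy hmono

/-- Spanning trees of a relabelled edge list `E ∘ σ` are the relabelled spanning trees (relabelling the
edges by the orderings `σ ∈ 𝔖_N` of Def. 2.4 / eq. (1.7)). [cite: Panzer2022, Def. 2.4 and §1 eq. (1.7) (orderings σ of the edges)] -/
theorem isSpanningTree_comp_perm (E : Fin N → Fin (V + 1) × Fin (V + 1)) (σ : Equiv.Perm (Fin N))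
    (T : Finset (Fin N)) :
    IsSpanningTree (E ∘ σ) T ↔ IsSpanningTree E (T.map σ.toEmbedding) := by
  unfold IsSpanningTree
  rw [edgeRank_comp_perm, Finset.card_map]

open scoped Classical in
/-- The number `|ST_G|` of spanning trees is invariant under relabelling the edges. [cite: Panzer2022, Def. 2.4 and §1 eq. (1.6) (|ST_G|)] -/
theorem card_filter_isSpanningTree_comp_perm (E : Fin N → Fin (V + 1) × Fin (V + 1))
    (σ : Equiv.Perm (Fin N)) :
    (univ.filter (IsSpanningTree (E ∘ σ))).card = (univ.filter (IsSpanningTree E)).card := by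
  refine Finset.card_bij (fun T _ => T.map σ.toEmbedding) (fun T hT => ?_)
    (fun T₁ _ T₂ _ h => Finset.map_injective σ.toEmbedding h) (fun T hT => ?_)
  · rw [Finset.mem_filter_univ] at hT ⊢
    exact (isSpanningTree_comp_perm E σ T).1 hT
  · refine ⟨T.map σ.symm.toEmbedding, ?_, ?_⟩
    · rw [Finset.mem_filter_univ] at hT ⊢
      rw [isSpanningTree_comp_perm, Finset.map_map]
      convert hT
      ext e
      simp
    · rw [Finset.map_map]
      ext e
      simp

/-- **Kruskal's tree of the labelling order** (Panzer 2022, Lemma 2.8: "the minimum weight spanning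
forest `T_σ` … is uniquely determined by the total order `σ` of the weights"). A connected edge list has a
spanning tree `T` meeting every prefix `G_m = {e < m}` in exactly `rk G_m` edges — the greedy row basis of
`GraphPeriodHeppBound.exists_greedyRows`; it depends on the ORDER of the edges only, not on any weights.
[cite: Panzer2022, §2.2 Lemma 2.8 (chunk p0007:L73–L76)] -/
theorem exists_greedy_isSpanningTree (E : Fin N → Fin (V + 1) × Fin (V + 1))
    (hc : IsConnectedEdgeList E) :
    ∃ T : Finset (Fin N), IsSpanningTree E T ∧
      ∀ m : ℕ, (T ∩ univ.filter fun k : Fin N => (k : ℕ) < m).card =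
        edgeRank E (univ.filter fun k : Fin N => (k : ℕ) < m) := by
  classical
  obtain ⟨T, hli, hTcount⟩ := exists_greedyRows ℚ (fun e => reducedIncidence ℚ E e)
  have hcount : ∀ m, (T ∩ univ.filter fun k : Fin N => (k : ℕ) < m).card =
      edgeRank E (univ.filter fun k : Fin N => (k : ℕ) < m) := fun m => by
    rw [hTcount, edgeRank_eq_finrank_span]
  have hc' : (reducedIncidence ℚ E).rank = V := hc
  have hTcard : T.card = V := by
    have := hcount N
    rwa [ltFilter_of_le le_rfl, Finset.inter_univ, edgeRank_univ, hc'] at this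
  refine ⟨T, ⟨hTcard, ?_⟩, hcount⟩
  have hI : (cycleMatroid E).Indep (T : Set (Fin N)) := by
    rw [cycleMatroid, vectorMatroid_indep_iff]
    exact ⟨Set.subset_univ _, hli⟩
  rw [(indep_cycleMatroid_iff_edgeRank E T).1 hI, hTcard]

/-- Relabelling a co-tree monomial `Π_{e∉T} y_e` along a permutation of the edges. [cite: Panzer2022, §2.2 eq. (∗) (the monomial Π_{e∉T_σ} x_e)] -/
theorem prod_compl_map_perm (σ : Equiv.Perm (Fin N)) (S : Finset (Fin N)) (y : Fin N → ℝ) :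
    ∏ e ∈ (S.map σ.toEmbedding)ᶜ, y e = ∏ e ∈ Sᶜ, y (σ e) := by
  have h : (S.map σ.toEmbedding)ᶜ = Sᶜ.map σ.toEmbedding := by
    ext e
    simp [Finset.mem_map_equiv]
  rw [h, Finset.prod_map]
  rfl

end SpanningTrees

/-! ### Ties are null: almost every point of the chart has pairwise distinct weights -/

section Ties

/-- The points `x ∈ ℝⁿ` whose weight vector `(x, 1)` has a tie (`x_a = x_b` for some `a ≠ b`, or
`x_a = 1`) form a Lebesgue-null set (a finite union of proper affine hyperplanes) — the complement of the
union of the OPEN Hepp sectors `H_σ = {0 < x_{σ(1)} < ⋯ < x_{σ(N)}}` of eq. (1.7) in the chart `x_N = 1`.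
[cite: Panzer2022, §1 eq. (1.7) and §2.2 ("Each summand is an integral over the projective simplex with 0 < x_{σ(1)} < ⋯ < x_{σ(N)}", chunk p0007:L64)] -/
theorem volume_setOf_not_injective_snoc (n : ℕ) :
    volume {x : Fin n → ℝ | ¬ Injective (Fin.snoc x (1 : ℝ) : Fin (n + 1) → ℝ)} = 0 := by
  have hsub : {x : Fin n → ℝ | ¬ Injective (Fin.snoc x (1 : ℝ) : Fin (n + 1) → ℝ)} ⊆
      (⋃ a : Fin n, ⋃ b : Fin n, {x : Fin n → ℝ | a ≠ b ∧ x a = x b}) ∪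
        ⋃ a : Fin n, {x : Fin n → ℝ | x a = 1} := by
    intro x hx
    obtain ⟨a, b, hab, hne⟩ := Function.not_injective_iff.1 hx
    rcases Fin.eq_castSucc_or_eq_last a with ⟨a', rfl⟩ | rfl <;>
    rcases Fin.eq_castSucc_or_eq_last b with ⟨b', rfl⟩ | rfl
    · simp only [Fin.snoc_castSucc] at hab
      refine Or.inl (Set.mem_iUnion.2 ⟨a', Set.mem_iUnion.2 ⟨b', ?_, hab⟩⟩)
      exact fun h => hne (by rw [h])
    · simp only [Fin.snoc_castSucc, Fin.snoc_last] at hab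
      exact Or.inr (Set.mem_iUnion.2 ⟨a', hab⟩)
    · simp only [Fin.snoc_castSucc, Fin.snoc_last] at hab
      exact Or.inr (Set.mem_iUnion.2 ⟨b', hab.symm⟩)
    · exact absurd rfl hne
  refine measure_mono_null hsub (measure_union_null
    (measure_iUnion_null fun a => measure_iUnion_null fun b => ?_) (measure_iUnion_null fun a => ?_))
  · -- the hyperplane `x_a = x_b`, a proper linear subspace
    by_cases hab : a = b
    · have h0 : {x : Fin n → ℝ | a ≠ b ∧ x a = x b} = ∅ := by
        ext x
        simp [hab]
      rw [h0, measure_empty]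
    · set K : Submodule ℝ (Fin n → ℝ) :=
        LinearMap.ker ((LinearMap.proj a : (Fin n → ℝ) →ₗ[ℝ] ℝ) - LinearMap.proj b) with hK
      have hset : {x : Fin n → ℝ | a ≠ b ∧ x a = x b} = (K : Set (Fin n → ℝ)) := by
        ext x
        simp [hK, sub_eq_zero, hab]
      have hne : K ≠ ⊤ := by
        intro h
        have hx : (Pi.single a (1 : ℝ) : Fin n → ℝ) ∈ K := by rw [h]; exact Submodule.mem_top
        simp [hK, Ne.symm hab] at hx
      rw [hset]
      exact Measure.addHaar_submodule volume K hne
  · -- the hyperplane `x_a = 1`, a slab of width zero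
    have hset : {x : Fin n → ℝ | x a = 1} =
        Set.univ.pi (Function.update (fun _ : Fin n => (Set.univ : Set ℝ)) a {1}) := by
      ext x
      simp only [Set.mem_setOf_eq, Set.mem_univ_pi, Function.update_apply]
      constructor
      · intro h i
        split_ifs with hi
        · subst hi; simpa using h
        · exact Set.mem_univ _
      · intro h
        simpa using h a
    rw [hset, volume_pi_pi]
    exact Finset.prod_eq_zero (Finset.mem_univ a) (by simp)

end Ties

/-! ### One ordering: the support of the sector function and the reverse pointwise bound -/

section Sector

variable {n V : ℕ} (E : Fin (n + 1) → Fin (V + 1) × Fin (V + 1)) (l : List (Fin (n + 1)))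
  {m : ℕ} {c : ℕ → Fin n} {d : ℕ → ℝ} {sv : (Fin n → ℝ) → ℕ → ℝ}
  {L U : ℕ → (Fin n → ℝ) → ℝ≥0∞}

omit E in
/-- **Support of the sector function.** If the sector function `L 0 x · U n x` of an ordering `l`
does not vanish at `x` and the weights `(x, 1)` are pairwise distinct, then `x` lies in the open
orthant and `l` IS the ordering sorting `(x, 1)` (`Tuple.sort`): the indicator constraints say
`0 < y_{l_0} ≤ y_{l_1} ≤ ⋯ ≤ y_{l_n}`, and a tie-free monotone arrangement is unique
(`Tuple.unique_monotone`). Hence distinct Hepp sectors `H_σ = {x_{σ(1)} < ⋯ < x_{σ(N)}}` (Panzer 2022,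
eq. (1.7); §2.2: "Each summand is an integral over the projective simplex with `0 < x_{σ(1)} < ⋯ < x_{σ(N)}`")
overlap only in the null set of ties. [cite: Panzer2022, §1 eq. (1.7) (Hepp sectors) and §2.2 (chunks p0003:L84–L90, p0007:L64)] -/
theorem mem_openOrthant_and_eq_ofFn_sort_of_sector_ne_zero
    (hl : (l : Multiset (Fin (n + 1))) = (univ : Finset (Fin (n + 1))).val)
    (hm : m = l.idxOf (Fin.last n))
    (hc : ∀ k, (c k : ℕ) = min (l.getD k (Fin.last n) : ℕ) (n - 1))
    (hsv : ∀ x k, sv x k = if k = m then 1 else x (c k))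
    (hL : ∀ i x, L i x = {x | 0 < sv x i ∧ ∀ k ∈ Ico i m,
      sv x k ≤ sv x (k + 1) ∧ 0 ≤ sv x k}.indicator 1 x *
        ∏ k ∈ Ico i m, ENNReal.ofReal (sv x k ^ (d (k + 1) - d k - 1)))
    (hU : ∀ j x, U j x = {x | 1 ≤ sv x j ∧ ∀ k ∈ Ico m j,
      sv x k ≤ sv x (k + 1) ∧ 1 ≤ sv x k}.indicator 1 x *
        ∏ k ∈ Ico (m + 1) (j + 1), ENNReal.ofReal (sv x k ^ (d (k + 1) - d k - 1)))
    (x : Fin n → ℝ) (hx : L 0 x * U n x ≠ 0)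
    (hinj : Injective (Fin.snoc x (1 : ℝ) : Fin (n + 1) → ℝ)) :
    x ∈ openOrthant n ∧ l = List.ofFn ⇑(Tuple.sort (Fin.snoc x (1 : ℝ) : Fin (n + 1) → ℝ)) := by
  set y : Fin (n + 1) → ℝ := Fin.snoc x 1 with hydef
  obtain ⟨hmn, hvm, hvne, hvinj⟩ := positions_of_ordering l hl hm
  obtain ⟨hnd, hlen, hmem⟩ := nodup_length_mem_of_coe_eq_univ hl
  -- the indicator constraints hold (else the sector function vanishes)
  have hmemL : x ∈ {x : Fin n → ℝ | 0 < sv x 0 ∧ ∀ k ∈ Ico 0 m,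
      sv x k ≤ sv x (k + 1) ∧ 0 ≤ sv x k} := by
    by_contra h
    exact left_ne_zero_of_mul hx (by rw [hL, Set.indicator_of_notMem h, zero_mul])
  have hmemU : x ∈ {x : Fin n → ℝ | 1 ≤ sv x n ∧ ∀ k ∈ Ico m n,
      sv x k ≤ sv x (k + 1) ∧ 1 ≤ sv x k} := by
    by_contra h
    exact right_ne_zero_of_mul hx (by rw [hU, Set.indicator_of_notMem h, zero_mul])
  obtain ⟨h0pos, hchainL⟩ := hmemL
  obtain ⟨-, hchainU⟩ := hmemU
  -- the values increase along the positions `0, …, n` and are positive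
  have hstep : ∀ k, k < n → sv x k ≤ sv x (k + 1) := by
    intro k hk
    rcases lt_or_ge k m with hkm | hkm
    · exact (hchainL k (Finset.mem_Ico.2 ⟨Nat.zero_le _, hkm⟩)).1
    · exact (hchainU k (Finset.mem_Ico.2 ⟨hkm, hk⟩)).1
  have hvalmono : ∀ k k', k ≤ k' → k' ≤ n → sv x k ≤ sv x k' := by
    intro k k' hkk' hk'
    induction k', hkk' using Nat.le_induction with
    | base => exact le_rfl
    | succ j hkj ih => exact (ih (by omega)).trans (hstep j (by omega))
  have hvalpos : ∀ k, k ≤ n → 0 < sv x k := fun k hk =>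
    h0pos.trans_le (hvalmono 0 k (Nat.zero_le _) hk)
  -- position `k` carries the edge `l_k`, whose weight is the value there
  have hval : ∀ k, k < n + 1 → sv x k = y (l.getD k (Fin.last n)) := by
    intro k hk
    rw [hsv]
    split_ifs with hkm
    · rw [hkm, hvm, hydef, Fin.snoc_last]
    · have hlt : (l.getD k (Fin.last n) : ℕ) < n := by
        have h1 := (l.getD k (Fin.last n)).isLt
        have h2 : (l.getD k (Fin.last n) : ℕ) ≠ n := fun h =>
          hvne k hk hkm (Fin.ext (by rw [h, Fin.val_last]))
        omega
      have hck : Fin.castSucc (c k) = l.getD k (Fin.last n) := by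
        apply Fin.ext
        rw [Fin.val_castSucc, hc k]
        omega
      rw [← hck, hydef, Fin.snoc_castSucc]
  refine ⟨fun e => ?_, ?_⟩
  · -- the coordinate `e` sits at the position of the edge `castSucc e`
    have hk := List.idxOf_lt_length_iff.2 (hmem (Fin.castSucc e))
    have hgk : l.getD (l.idxOf (Fin.castSucc e)) (Fin.last n) = Fin.castSucc e := by
      rw [List.getD_eq_getElem _ _ hk]; exact List.getElem_idxOf hk
    have hkm : l.idxOf (Fin.castSucc e) ≠ m := fun h => by
      rw [h, hvm] at hgk
      exact (Fin.castSucc_lt_last e).ne hgk.symm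
    have hpos := hvalpos (l.idxOf (Fin.castSucc e)) (by omega)
    rwa [hval _ (by omega), hgk, hydef, Fin.snoc_castSucc] at hpos
  · -- no ties: the ordering is the sorting permutation
    have hτbij : Bijective (fun k : Fin (n + 1) => l.getD k (Fin.last n)) := by
      rw [Fintype.bijective_iff_injective_and_card]
      exact ⟨fun k k' h => Fin.ext (hvinj k k' k.isLt k'.isLt h), rfl⟩
    set τ : Equiv.Perm (Fin (n + 1)) := Equiv.ofBijective _ hτbij with hτ
    have hτmono : Monotone (y ∘ τ) := by
      intro k k' hkk'
      show y (l.getD k (Fin.last n)) ≤ y (l.getD k' (Fin.last n))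
      rw [← hval k k.isLt, ← hval k' k'.isLt]
      exact hvalmono k k' hkk' (by omega)
    have hστ : y ∘ τ = y ∘ Tuple.sort y := Tuple.unique_monotone hτmono (Tuple.monotone_sort y)
    have hτσ : τ = Tuple.sort y := Equiv.ext fun k => hinj (congrFun hστ k)
    apply List.ext_getElem
    · rw [List.length_ofFn, hlen]
    · intro k hk hk'
      have h1 : (List.ofFn ⇑(Tuple.sort y))[k] = Tuple.sort y ⟨k, by omega⟩ := by
        rw [List.getElem_ofFn]
      rw [h1, ← hτσ]
      show l[k] = l.getD k (Fin.last n)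
      rw [List.getD_eq_getElem _ _ hk]

end Sector

/-! ### Uniqueness of the dominating tree on an open sector (v2) -/

section Uniqueness

variable {N V : ℕ}

/-- Strict majorization: under the hypotheses of the majorization lemma, if moreover `S ≠ T` and the
weights are STRICTLY increasing, then `Π_{e∈T} y_e < Π_{e∈S} y_e`. [folklore] -/
private theorem prod_lt_prod_of_card_inter_ltFilter_le_of_ne {S T : Finset (Fin N)} {r : ℕ}
    (hS : S.card = r) (hT : T.card = r)
    (h : ∀ m : ℕ, (S ∩ univ.filter fun k : Fin N => (k : ℕ) < m).card ≤
      (T ∩ univ.filter fun k : Fin N => (k : ℕ) < m).card)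
    (hne : S ≠ T) (y : Fin N → ℝ) (hy : ∀ k, 0 < y k) (hmono : StrictMono y) :
    ∏ e ∈ T, y e < ∏ e ∈ S, y e := by
  have hex : ∃ i : Fin r, T.orderEmbOfFin hT i ≠ S.orderEmbOfFin hS i := by
    by_contra hall
    apply hne
    have heq : (S.orderEmbOfFin hS : Fin r → Fin N) = T.orderEmbOfFin hT :=
      funext fun i => (not_not.1 (not_exists.1 hall i)).symm
    rw [← Finset.image_orderEmbOfFin_univ S hS, ← Finset.image_orderEmbOfFin_univ T hT, heq]
  obtain ⟨i, hi⟩ := hex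
  have hlt : T.orderEmbOfFin hT i < S.orderEmbOfFin hS i :=
    lt_of_le_of_ne (orderEmbOfFin_le_of_card_inter_ltFilter_le hS hT h i) hi
  rw [← Finset.image_orderEmbOfFin_univ T hT, ← Finset.image_orderEmbOfFin_univ S hS,
    Finset.prod_image fun a _ b _ hab => (T.orderEmbOfFin hT).injective hab,
    Finset.prod_image fun a _ b _ hab => (S.orderEmbOfFin hS).injective hab]
  exact Finset.prod_lt_prod (fun j _ => hy _)
    (fun j _ => hmono.monotone (orderEmbOfFin_le_of_card_inter_ltFilter_le hS hT h j))
    ⟨i, Finset.mem_univ _, hmono hlt⟩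

/-- **Strict dominance on an open Hepp sector.** For weights that are STRICTLY increasing along the labelling
(an open sector `y₀ < y₁ < ⋯`, no ties), Kruskal's tree `T` STRICTLY dominates every other spanning tree:
`Π_{e∉T'} y_e < Π_{e∉T} y_e` for `T' ≠ T` (Panzer 2022, §2.2: "within every sector `H_σ`, there is a
UNIQUE spanning tree `T_σ` that dominates all others"). [cite: Panzer2022, §2.2 eq. (∗) and Lemma 2.8 (chunk p0007:L64–L76)] -/
theorem IsSpanningTree.prod_compl_lt_of_greedy_of_ne {E : Fin N → Fin (V + 1) × Fin (V + 1)}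
    {T' : Finset (Fin N)} (hT' : IsSpanningTree E T') {T : Finset (Fin N)} (hT : T.card = V)
    (hcount : ∀ m : ℕ, (T ∩ univ.filter fun k : Fin N => (k : ℕ) < m).card =
      edgeRank E (univ.filter fun k : Fin N => (k : ℕ) < m))
    (hne : T' ≠ T) (y : Fin N → ℝ) (hy : ∀ e, 0 < y e) (hmono : StrictMono y) :
    ∏ e ∈ T'ᶜ, y e < ∏ e ∈ Tᶜ, y e := by
  have hlt := prod_lt_prod_of_card_inter_ltFilter_le_of_ne hT'.1 hT
    (fun m => (hT'.card_inter_le_edgeRank _).trans (hcount m).ge) hne y hy hmono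
  have hposS : 0 < ∏ e ∈ T', y e := Finset.prod_pos fun e _ => hy e
  have hU : (∏ e ∈ T'ᶜ, y e) * ∏ e ∈ T', y e = (∏ e ∈ Tᶜ, y e) * ∏ e ∈ T, y e := by
    rw [mul_comm, Finset.prod_mul_prod_compl, mul_comm, Finset.prod_mul_prod_compl]
  refine lt_of_mul_lt_mul_right ?_ hposS.le
  rw [hU]
  exact mul_lt_mul_of_pos_left hlt (Finset.prod_pos fun e _ => hy e)

/-- **Uniqueness of the dominating tree on an open sector** (Panzer 2022, §2.2: "a unique spanning tree
`T_σ ∈ ST_G` that dominates all others"; Lemma 2.8: "`T_σ` is uniquely determined by the total order `σ`"):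
for a connected edge list and STRICTLY increasing weights, a spanning tree whose co-tree monomial is maximal
IS Kruskal's tree. [cite: Panzer2022, §2.2 eq. (∗) and Lemma 2.8 (chunk p0007:L64–L76)] -/
theorem IsSpanningTree.eq_greedy_of_forall_prod_compl_le {E : Fin N → Fin (V + 1) × Fin (V + 1)}
    {T₁ : Finset (Fin N)} (hT₁ : IsSpanningTree E T₁) {T : Finset (Fin N)} (hT : IsSpanningTree E T)
    (hcount : ∀ m : ℕ, (T ∩ univ.filter fun k : Fin N => (k : ℕ) < m).card =
      edgeRank E (univ.filter fun k : Fin N => (k : ℕ) < m))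
    (y : Fin N → ℝ) (hy : ∀ e, 0 < y e) (hmono : StrictMono y)
    (hdom : ∀ T', IsSpanningTree E T' → ∏ e ∈ T'ᶜ, y e ≤ ∏ e ∈ T₁ᶜ, y e) : T₁ = T := by
  by_contra hne
  exact not_le.2 (hT₁.prod_compl_lt_of_greedy_of_ne hT.1 hcount hne y hy hmono) (hdom T hT)

end Uniqueness

end Literature.MathematicalPhysics.QuantumFieldTheory
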